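import Summits.KontsevichZagierPeriods.KontsevichZagierPeriods.Theorems.LinRedNormalFormArrangementNormalFormStubRebaseSimpleZeroNestedBlowMap

/-!
# Stub `stub_rebaseSimpleZeroTwo`, part `rebaseSimpleZero_nestedBlowUp` (crux `ArrangementNormalForm`,
line `janus-bands`, v6.2) — brick `NestedBlowUpChart`

The pinch-vertex blow-up chart of a nested pair over a one-dimensional base (drefute g3, §5)
with the rescaled RADIAL fibre `Z` placed on EITHER literal fibre `k : Fin 2` (the landed brick
`NestedBlowMap` is the case `k = 1`):
`RebaseNest.bmap ε y₀ t₀ k (b, s₀, s₁)` has base `y₀ + ε Z/b`, radial fibre `t₀ + ε Z` and polar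
fibre `t₀ + ε a Z/b`, where `Z = s_k` and `a = s_{k'}` (`k' ≠ k`). We record, uniformly in `k`,
the explicit Jacobian `RebaseNest.bjac` (`bmap_hasFDerivAt`), its determinant `−ε³ Z²/b³`
(`bjac_det`), injectivity off `b Z = 0` (`bmap_injOn`), `ℚ`-semialgebraicity off `b = 0`
(`bmap_isSemialgebraicMapOn`) and the coordinate formulas (`bmap_base/rad/pol`), plus three
pieces of sign bookkeeping used by the move (`slope_iff`, `pos_of_chain`, `prod_pair`).
Registered support goal: `rebaseSimpleZero_nestedBlowUpChart`.

References: M. Kontsevich, D. Zagier, *Periods* (2001), §1.2, rule (2).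
-/

noncomputable section

open Set MeasureTheory MvPolynomial
open Literature.NumberTheory.Transcendental Literature.ModelTheory.ExponentialFields

namespace Summit.KontsevichZagierPeriods.ArrangementNormalForm.JanusBands

namespace RebaseNest

section BlowMapZero

variable (ε y₀ t₀ : ℝ)

/-- The Jacobian matrix of the blow-up chart with the radial fibre FIRST, applied to a vector. -/
theorem blow0_jac_apply (w v : Fin 3 → ℝ) :
    Matrix.toLin' !![-(ε * w 1) / w 0 ^ 2, ε / w 0, 0; 0, ε, 0;
      -(ε * w 2 * w 1) / w 0 ^ 2, ε * w 2 / w 0, ε * w 1 / w 0] v =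
      ![-(ε * w 1) / w 0 ^ 2 * v 0 + ε / w 0 * v 1, ε * v 1,
        -(ε * w 2 * w 1) / w 0 ^ 2 * v 0 + ε * w 2 / w 0 * v 1 + ε * w 1 / w 0 * v 2] := by
  ext k
  fin_cases k <;> simp [Matrix.toLin'_apply, Matrix.mulVec, dotProduct, Fin.sum_univ_three]

/-- The Jacobian determinant of the blow-up chart with the radial fibre first: `−ε³ Z²/b³`. -/
theorem blow0_det (w : Fin 3 → ℝ) (hw : w 0 ≠ 0) :
    (LinearMap.toContinuousLinearMap (Matrix.toLin' !![-(ε * w 1) / w 0 ^ 2, ε / w 0, 0; 0, ε, 0;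
      -(ε * w 2 * w 1) / w 0 ^ 2, ε * w 2 / w 0, ε * w 1 / w 0])).det =
      -(ε ^ 3 * w 1 ^ 2 / w 0 ^ 3) := by
  rw [ContinuousLinearMap.det, LinearMap.coe_toContinuousLinearMap, LinearMap.det_toLin',
    Matrix.det_fin_three]
  simp only [Matrix.of_apply, Matrix.cons_val', Matrix.cons_val_zero, Matrix.cons_val_one,
    Matrix.cons_val_two, Matrix.empty_val', Matrix.cons_val_fin_one, Matrix.head_cons, Matrix.tail_cons,
    Matrix.head_fin_const]
  field_simp
  ring

/-- The blow-up chart with the radial fibre first is differentiable off `b = 0`, with the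
explicit Jacobian. -/
theorem blow0_hasFDerivAt (w : Fin 3 → ℝ) (hw : w 0 ≠ 0) :
    HasFDerivAt (fun w : Fin 3 → ℝ => (![y₀ + ε * w 1 / w 0, t₀ + ε * w 1, t₀ + ε * w 2 * w 1 / w 0] :
        Fin 3 → ℝ))
      (LinearMap.toContinuousLinearMap (Matrix.toLin' !![-(ε * w 1) / w 0 ^ 2, ε / w 0, 0; 0, ε, 0;
        -(ε * w 2 * w 1) / w 0 ^ 2, ε * w 2 / w 0, ε * w 1 / w 0])) w := by
  -- adapted from `RebaseNest.blow_hasFDerivAt` (brick `NestedBlowMap`)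
  have h0 : HasFDerivAt (fun x : Fin 3 → ℝ => x 0)
      (ContinuousLinearMap.proj (R := ℝ) (φ := fun _ : Fin 3 => ℝ) 0) w := hasFDerivAt_apply 0 w
  have h1 : HasFDerivAt (fun x : Fin 3 → ℝ => x 1)
      (ContinuousLinearMap.proj (R := ℝ) (φ := fun _ : Fin 3 => ℝ) 1) w := hasFDerivAt_apply 1 w
  have h2 : HasFDerivAt (fun x : Fin 3 → ℝ => x 2)
      (ContinuousLinearMap.proj (R := ℝ) (φ := fun _ : Fin 3 => ℝ) 2) w := hasFDerivAt_apply 2 w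
  have hinv : HasFDerivAt (fun x : Fin 3 → ℝ => (x 0)⁻¹)
      ((ContinuousLinearMap.toSpanSingleton ℝ (-(w 0 ^ 2)⁻¹)).comp
        (ContinuousLinearMap.proj (R := ℝ) (φ := fun _ : Fin 3 => ℝ) 0)) w :=
    (hasFDerivAt_inv hw).comp w h0
  rw [hasFDerivAt_pi']
  refine Fin.forall_fin_succ.2 ⟨?_, Fin.forall_fin_two.2 ⟨?_, ?_⟩⟩
  · show HasFDerivAt (fun x : Fin 3 → ℝ => y₀ + ε * x 1 / x 0) _ w
    have := ((h1.const_mul ε).mul hinv).const_add y₀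
    refine (this.congr_of_eventuallyEq (Filter.Eventually.of_forall fun x => by
      simp [div_eq_mul_inv])).congr_fderiv (ContinuousLinearMap.ext fun v => ?_)
    rw [ContinuousLinearMap.comp_apply, LinearMap.coe_toContinuousLinearMap', blow0_jac_apply]
    simp
    field_simp
  · show HasFDerivAt (fun x : Fin 3 → ℝ => t₀ + ε * x 1) _ w
    refine ((h1.const_mul ε).const_add t₀).congr_fderiv (ContinuousLinearMap.ext fun v => ?_)
    rw [ContinuousLinearMap.comp_apply, LinearMap.coe_toContinuousLinearMap']
    erw [blow0_jac_apply]
    simp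
  · show HasFDerivAt (fun x : Fin 3 → ℝ => t₀ + ε * x 2 * x 1 / x 0) _ w
    have := ((((h2.const_mul ε).mul h1).mul hinv).const_add t₀)
    refine (this.congr_of_eventuallyEq (Filter.Eventually.of_forall fun x => by
      simp [div_eq_mul_inv])).congr_fderiv (ContinuousLinearMap.ext fun v => ?_)
    rw [ContinuousLinearMap.comp_apply, LinearMap.coe_toContinuousLinearMap']
    erw [blow0_jac_apply]
    simp
    field_simp
    ring

/-- The blow-up chart with the radial fibre first is injective off `b Z = 0` (for `ε ≠ 0`). -/
theorem blow0_injOn (hε : ε ≠ 0) {Q : Set (Fin 3 → ℝ)} (hQ : ∀ w ∈ Q, w 0 ≠ 0 ∧ w 1 ≠ 0) :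
    InjOn (fun w : Fin 3 → ℝ => (![y₀ + ε * w 1 / w 0, t₀ + ε * w 1, t₀ + ε * w 2 * w 1 / w 0] :
      Fin 3 → ℝ)) Q := by
  -- adapted from `RebaseNest.blow_injOn` (brick `NestedBlowMap`)
  intro w hw w' hw' h
  obtain ⟨hb, hZ⟩ := hQ w hw
  obtain ⟨hb', -⟩ := hQ w' hw'
  have e0 := congr_fun h 0
  have e1 := congr_fun h 1
  have e2 := congr_fun h 2
  simp only [Matrix.cons_val_zero, Matrix.cons_val_one, Matrix.cons_val_two, Matrix.head_cons,
    Matrix.tail_cons, add_right_inj] at e0 e1 e2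
  have h1 : w 1 = w' 1 := mul_left_cancel₀ hε e1
  have hεZ : ε * w 1 ≠ 0 := mul_ne_zero hε hZ
  have h0 : w 0 = w' 0 := by
    rw [← h1, div_eq_div_iff hb hb'] at e0
    exact (mul_left_cancel₀ hεZ e0).symm
  have h2 : w 2 = w' 2 := by
    rw [← h1, ← h0, div_left_inj' hb] at e2
    have : ε * w 1 * (w 2 - w' 2) = 0 := by linear_combination e2
    simpa [hεZ, sub_eq_zero] using this
  ext k
  fin_cases k
  exacts [h0, h1, h2]

/-- The blow-up chart with the radial fibre first and rational data is a `ℚ`-semialgebraic map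
on any semialgebraic set missing `b = 0`. -/
theorem blow0_isSemialgebraicMapOn (ε y₀ t₀ : ℚ) {Q : Set (Fin 3 → ℝ)} (hQ : IsSemialgebraic ℚ Q)
    (hQ0 : ∀ w ∈ Q, w 0 ≠ 0) :
    IsSemialgebraicMapOn ℚ Q (fun w : Fin 3 → ℝ => (![y₀ + ε * w 1 / w 0, t₀ + ε * w 1,
      t₀ + ε * w 2 * w 1 / w 0] : Fin 3 → ℝ)) := by
  -- adapted from `RebaseNest.blow_isSemialgebraicMapOn` (brick `NestedBlowMap`)
  have hX : ∀ w ∈ Q, aeval w (X 0 : MvPolynomial (Fin 3) ℚ) ≠ 0 := fun w hw => by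
    simpa using hQ0 w hw
  refine IsSemialgebraicMapOn.of_forall hQ (Fin.forall_fin_succ.2 ⟨?_, Fin.forall_fin_two.2 ⟨?_, ?_⟩⟩)
  · refine (isSemialgebraicFunOn_aeval_div_aeval hQ (C y₀ * X 0 + C ε * X 1) (X 0) hX).congr
      fun w hw => ?_
    have h0 := hQ0 w hw
    simp only [map_add, map_mul, aeval_C, aeval_X, eq_ratCast, Matrix.cons_val_zero]
    field_simp
  · refine (isSemialgebraicFunOn_aeval hQ (C t₀ + C ε * X 1)).congr fun w _ => ?_
    simp
  · refine (isSemialgebraicFunOn_aeval_div_aeval hQ (C t₀ * X 0 + C ε * X 2 * X 1) (X 0) hX).congr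
      fun w hw => ?_
    have h0 := hQ0 w hw
    show _ = (t₀ : ℝ) + ε * w 2 * w 1 / w 0
    simp only [map_add, map_mul, aeval_C, aeval_X, eq_ratCast]
    field_simp

end BlowMapZero

section BlowMapK

variable (ε y₀ t₀ : ℝ)

/-- The blow-up chart with the rescaled radial fibre `Z` on the literal fibre `k` and the polar
fibre `a` on the other one: base `y₀ + ε Z/b`, radial fibre `t₀ + ε Z`, polar fibre
`t₀ + ε a Z/b`. -/
def bmap (k : Fin 2) : (Fin 3 → ℝ) → (Fin 3 → ℝ) :=
  ![fun w => ![y₀ + ε * w 1 / w 0, t₀ + ε * w 1, t₀ + ε * w 2 * w 1 / w 0],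
    fun w => ![y₀ + ε * w 2 / w 0, t₀ + ε * w 1 * w 2 / w 0, t₀ + ε * w 2]] k

/-- The Jacobian of `bmap ε y₀ t₀ k` at `w`. -/
def bjac (k : Fin 2) (w : Fin 3 → ℝ) : (Fin 3 → ℝ) →L[ℝ] (Fin 3 → ℝ) :=
  ![LinearMap.toContinuousLinearMap (Matrix.toLin' !![-(ε * w 1) / w 0 ^ 2, ε / w 0, 0; 0, ε, 0;
      -(ε * w 2 * w 1) / w 0 ^ 2, ε * w 2 / w 0, ε * w 1 / w 0]),
    LinearMap.toContinuousLinearMap (Matrix.toLin' !![-(ε * w 2) / w 0 ^ 2, 0, ε / w 0;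
      -(ε * w 1 * w 2) / w 0 ^ 2, ε * w 2 / w 0, ε * w 1 / w 0; 0, 0, ε])] k

/-- `bmap` is differentiable off `b = 0`, with derivative `bjac`. -/
theorem bmap_hasFDerivAt (k : Fin 2) (w : Fin 3 → ℝ) (hw : w 0 ≠ 0) :
    HasFDerivAt (bmap ε y₀ t₀ k) (bjac ε k w) w := by
  fin_cases k
  · exact blow0_hasFDerivAt ε y₀ t₀ w hw
  · exact blow_hasFDerivAt ε y₀ t₀ w hw

/-- The Jacobian determinant of `bmap`: `−ε³ Z²/b³`, `Z` the radial fibre `k`. -/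
theorem bjac_det (k : Fin 2) (w : Fin 3 → ℝ) (hw : w 0 ≠ 0) :
    (bjac ε k w).det = -(ε ^ 3 * w (Fin.natAdd (0 + 1) k) ^ 2 / w 0 ^ 3) := by
  fin_cases k
  · exact blow0_det ε w hw
  · exact blow_det ε w hw

/-- `bmap` is injective off `b Z = 0` (for `ε ≠ 0`). -/
theorem bmap_injOn (hε : ε ≠ 0) (k : Fin 2) {Q : Set (Fin 3 → ℝ)}
    (hQ : ∀ w ∈ Q, w 0 ≠ 0 ∧ w (Fin.natAdd (0 + 1) k) ≠ 0) : InjOn (bmap ε y₀ t₀ k) Q := by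
  fin_cases k
  · exact blow0_injOn ε y₀ t₀ hε hQ
  · exact blow_injOn ε y₀ t₀ hε hQ

/-- `bmap` with rational data is a `ℚ`-semialgebraic map on semialgebraic sets missing `b = 0`. -/
theorem bmap_isSemialgebraicMapOn (ε y₀ t₀ : ℚ) (k : Fin 2) {Q : Set (Fin 3 → ℝ)}
    (hQ : IsSemialgebraic ℚ Q) (hQ0 : ∀ w ∈ Q, w 0 ≠ 0) :
    IsSemialgebraicMapOn ℚ Q (bmap (ε : ℝ) (y₀ : ℝ) (t₀ : ℝ) k) := by
  fin_cases k
  · exact blow0_isSemialgebraicMapOn ε y₀ t₀ hQ hQ0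
  · exact blow_isSemialgebraicMapOn ε y₀ t₀ hQ hQ0

/-- The base coordinate of `bmap`: `y₀ + ε Z/b`. -/
theorem bmap_base (k : Fin 2) (w : Fin 3 → ℝ) :
    bmap ε y₀ t₀ k w 0 = y₀ + ε * w (Fin.natAdd (0 + 1) k) / w 0 := by
  fin_cases k <;> rfl

/-- The radial fibre of `bmap`: `t₀ + ε Z`. -/
theorem bmap_rad (k : Fin 2) (w : Fin 3 → ℝ) :
    bmap ε y₀ t₀ k w (Fin.natAdd (0 + 1) k) = t₀ + ε * w (Fin.natAdd (0 + 1) k) := by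
  fin_cases k <;> rfl

/-- The polar fibre of `bmap`: `t₀ + ε a Z/b`. -/
theorem bmap_pol {k k' : Fin 2} (hk : k' ≠ k) (w : Fin 3 → ℝ) :
    bmap ε y₀ t₀ k w (Fin.natAdd (0 + 1) k') =
      t₀ + ε * w (Fin.natAdd (0 + 1) k') * w (Fin.natAdd (0 + 1) k) / w 0 := by
  fin_cases k <;> fin_cases k'
  · exact absurd rfl hk
  · rfl
  · rfl
  · exact absurd rfl hk

end BlowMapK

section Signs

/-- Dividing an inequality by a signed quantity: if `ε₁² = 1` and `ε₁ y > 0` then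
`c y < d y ↔ ε₁ c < ε₁ d`. [folklore] -/
theorem slope_iff {ε₁ y c d : ℝ} (hε : ε₁ * ε₁ = 1) (hy : 0 < ε₁ * y) :
    c * y < d * y ↔ ε₁ * c < ε₁ * d := by
  have key : d * y - c * y = (ε₁ * d - ε₁ * c) * (ε₁ * y) := by
    linear_combination (-(d - c) * y) * hε
  rw [← sub_pos, key, mul_pos_iff_of_pos_right hy, sub_pos]

/-- Sign of the radial slope: if `ε₁ α < ε₁ b < ε₁ β` with `σ α, σ β ≥ 0` (`ε₁, σ = ±1`), then
`σ b > 0`. [folklore] -/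
theorem pos_of_chain {ε₁ σ α β b : ℝ} (hε₁ : ε₁ = 1 ∨ ε₁ = -1) (hσ : σ = 1 ∨ σ = -1)
    (hα : 0 ≤ σ * α) (hβ : 0 ≤ σ * β) (h1 : ε₁ * α < ε₁ * b) (h2 : ε₁ * b < ε₁ * β) : 0 < σ * b := by
  rcases hε₁ with rfl | rfl <;> rcases hσ with rfl | rfl <;> linarith

/-- A product over the two fibres, read on an ordered pair. [folklore] -/
theorem prod_pair {M : Type*} [CommMonoid M] {k k' : Fin 2} (hk : k' ≠ k) (f : Fin 2 → M) :
    ∏ l, f l = f k' * f k := by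
  rw [Fin.prod_univ_two]
  fin_cases k <;> fin_cases k'
  · exact absurd rfl hk
  · exact mul_comm _ _
  · rfl
  · exact absurd rfl hk

end Signs

end RebaseNest

/-- **Registered part of `stub_rebaseSimpleZeroTwo` / `rebaseSimpleZero_nestedBlowUp` (line
`janus-bands`, v6.2): calculus of the pinch-vertex blow-up chart with the radial fibre on either
literal fibre `k`** (`RebaseNest.bmap`): off `b = 0` the explicit Jacobian `RebaseNest.bjac` is
the derivative and its determinant is `−ε³ Z²/b³`, `Z` the radial fibre.
[Kontsevich–Zagier 2001, §1.2, rule (2)] -/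
theorem rebaseSimpleZero_nestedBlowUpChart (ε y₀ t₀ : ℝ) (k : Fin 2) (w : Fin 3 → ℝ) (hw : w 0 ≠ 0) : HasFDerivAt (RebaseNest.bmap ε y₀ t₀ k) (RebaseNest.bjac ε k w) w ∧ (RebaseNest.bjac ε k w).det = -(ε ^ 3 * w (Fin.natAdd (0 + 1) k) ^ 2 / w 0 ^ 3) :=
  ⟨RebaseNest.bmap_hasFDerivAt ε y₀ t₀ k w hw, RebaseNest.bjac_det ε k w hw⟩

end Summit.KontsevichZagierPeriods.ArrangementNormalForm.JanusBands
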